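import Literature.Geometry.DiscreteGeometry.SphericalCodeHemisphere
import Literature.Geometry.DiscreteGeometry.KissingFacets
import HarnessLib

/-!
# `RobustTangencyBound` — a quantitative facet height for twelve soft unit vectors, and the
# resulting lower bound on the inner product of two vertices of one facet (step (III))

Route `TwoCentreKissingKernel`, item `stmt-AtomisticToContinuum-12082`, blueprint (III) §8/§11.  In the soft setting
(pairwise `⟪·,·⟫ ≤ 1/2 + 2η`) the exact kissing-number argument of `KissingFacets.lean`
(`norm_lt_two_of_mem_facetNormals`, height `> 1/2`) is not available; instead we generalise the
cone-volume count of `SphericalCodeHemisphere.lean` from a hemisphere to the cap complement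
`⟪a, ·⟫ ≥ −t`:

* `not_mem_capCone_neg_of_ge` — cones about points with `⟪a, x⟫ ≥ −t` miss `capCone (−a) (t + √(1−c²))`;
* `card_mul_le_of_code_above` — `|X| (1 − c) ≤ 1 + √(1 − c²) + t`;
* `facet_height_gt` — for twelve unit vectors with pairwise `⟪·,·⟫ ≤ 0.502` every facet normal
  has `‖c‖⁻¹ > 1/10` (take `c = 0.86661`);
* `inner_gt_of_common_facet` — two vertices of one facet satisfy `⟪y, y'⟫ > −98/100`
  (`≥ 2t² − 1`, Cauchy–Schwarz for the centred vectors as in `neg_half_lt_inner_of_tight`).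
The last bound justifies the range `[−0.98, 0.502]` of the hexagon diagonals without a soft
two-path (`work/factory/hexagons.py`).
-/

noncomputable section

namespace Summit.AtomisticToContinuum.Crystallization.Theorems

open Real RealInnerProductSpace MeasureTheory Measure Metric Set Literature.Geometry.DiscreteGeometry Finset

/-- **Cones about points of the cap complement `⟪a, ·⟫ ≥ −t` miss the cone of parameter
`t + √(1 − c²)` about `−a`.** -/
theorem not_mem_capCone_neg_of_ge {a x y : EuclideanSpace ℝ (Fin 3)} (ha : ‖a‖ = 1) (hx : ‖x‖ = 1)
    {t : ℝ} (ht : 0 ≤ t) (hax : -t ≤ ⟪a, x⟫) {c : ℝ} (hc : 0 ≤ c) (hy : y ∈ capCone x c) :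
    y ∉ capCone (-a) (t + Real.sqrt (1 - c ^ 2)) := by
  intro hy'
  have hy0 := ne_zero_of_mem_capCone hy
  set u : EuclideanSpace ℝ (Fin 3) := ‖y‖⁻¹ • y with hu
  have hun : ‖u‖ = 1 := by
    rw [hu, norm_smul, norm_inv, norm_norm, inv_mul_cancel₀ (norm_ne_zero_iff.2 hy0)]
  have h1 : c < ⟪x, u⟫ := lt_inner_normalise_of_mem_capCone hy
  have h2 : t + Real.sqrt (1 - c ^ 2) < ⟪-a, u⟫ := lt_inner_normalise_of_mem_capCone hy'
  rw [inner_neg_left] at h2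
  have htri := inner_mul_inner_sub_sqrt_le hx ha hun
  rw [real_inner_comm a x] at htri
  have hxu1 : ⟪x, u⟫ ≤ 1 := by
    have := real_inner_le_norm x u; rw [hx, hun, one_mul] at this; exact this
  have hax1 : ⟪a, x⟫ ≤ 1 := by
    have := real_inner_le_norm a x; rw [ha, hx, one_mul] at this; exact this
  have hA : Real.sqrt (1 - ⟪x, u⟫ ^ 2) ≤ Real.sqrt (1 - c ^ 2) := by
    apply Real.sqrt_le_sqrt; nlinarith
  have hB : Real.sqrt (1 - ⟪a, x⟫ ^ 2) ≤ 1 := by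
    rw [Real.sqrt_le_one]; nlinarith
  have hs0 : 0 ≤ Real.sqrt (1 - ⟪x, u⟫ ^ 2) := Real.sqrt_nonneg _
  have hs0' : 0 ≤ Real.sqrt (1 - ⟪a, x⟫ ^ 2) := Real.sqrt_nonneg _
  have hprod : Real.sqrt (1 - ⟪a, x⟫ ^ 2) * Real.sqrt (1 - ⟪x, u⟫ ^ 2) ≤
      1 * Real.sqrt (1 - c ^ 2) := mul_le_mul hB hA hs0 zero_le_one
  -- `⟪a, x⟫ ⟪x, u⟫ ≥ −t`: if `⟪a,x⟫ ≥ 0` the product is `≥ 0`, else it is `≥ ⟪a, x⟫ ≥ −t`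
  have hpos : -t ≤ ⟪a, x⟫ * ⟪x, u⟫ := by
    have hxu0 : 0 ≤ ⟪x, u⟫ := hc.trans h1.le
    rcases le_or_gt 0 ⟪a, x⟫ with hax0 | hax0
    · nlinarith [mul_nonneg hax0 hxu0]
    · nlinarith [mul_le_mul_of_nonpos_left hxu1 hax0.le]
  linarith

/-- **The cap-packing bound above the level `−t`.** Unit vectors with pairwise inner products
`≤ 2c² − 1` (`0 < c ≤ 1`), all with `⟪a, x⟫ ≥ −t` (`0 ≤ t`, `t + √(1 − c²) ≤ 1`) number at most
`(1 + √(1 − c²) + t)/(1 − c)`. -/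
theorem card_mul_le_of_code_above {X : Finset (EuclideanSpace ℝ (Fin 3))}
    (hX1 : ∀ x ∈ X, ‖x‖ = 1) {c : ℝ} (hc : 0 < c) (hc1 : c ≤ 1)
    (hsep : ∀ x ∈ X, ∀ x' ∈ X, x ≠ x' → ⟪x, x'⟫ ≤ 2 * c ^ 2 - 1)
    {a : EuclideanSpace ℝ (Fin 3)} (ha : ‖a‖ = 1) {t : ℝ} (ht : 0 ≤ t)
    (hts : t + Real.sqrt (1 - c ^ 2) ≤ 1) (habove : ∀ x ∈ X, -t ≤ ⟪a, x⟫) :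
    (X.card : ℝ) * (1 - c) ≤ 1 + Real.sqrt (1 - c ^ 2) + t := by
  set s := t + Real.sqrt (1 - c ^ 2) with hs
  have hsq0 : 0 ≤ Real.sqrt (1 - c ^ 2) := Real.sqrt_nonneg _
  have hs0 : 0 ≤ s := add_nonneg ht hsq0
  have hs1 : s ≤ 1 := hts
  have hna : ‖-a‖ = 1 := by rw [norm_neg, ha]
  set U : Set (EuclideanSpace ℝ (Fin 3)) := ⋃ x ∈ X, capCone x c with hU
  have hUsub : U ⊆ ball 0 1 \ capCone (-a) s := by
    intro y hy
    rw [hU, Set.mem_iUnion₂] at hy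
    obtain ⟨x, hx, hyx⟩ := hy
    exact ⟨capCone_subset_ball x c hyx,
      not_mem_capCone_neg_of_ge ha (hX1 x hx) ht (habove x hx) hc.le hyx⟩
  have hdisj : Set.PairwiseDisjoint (↑X : Set (EuclideanSpace ℝ (Fin 3))) fun x => capCone x c := by
    intro x hx x' hx' hne
    exact disjoint_capCone (hX1 x hx) (hX1 x' hx') hc.le hc1 (hsep x hx x' hx' hne)
  have hUvol : volume U = ∑ x ∈ X, volume (capCone x c) :=
    measure_biUnion_finset hdisj fun x _ => measurableSet_capCone x c
  have hcone : ∀ x ∈ X, volume (capCone x c) = ENNReal.ofReal (2 * π / 3 * (1 - c)) :=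
    fun x hx => volume_capCone (hX1 x hx) hc hc1
  rw [Finset.sum_congr rfl hcone, Finset.sum_const, nsmul_eq_mul] at hUvol
  have hdiff : volume (ball (0 : EuclideanSpace ℝ (Fin 3)) 1 \ capCone (-a) s) =
      volume (ball (0 : EuclideanSpace ℝ (Fin 3)) 1) - volume (capCone (-a) s) :=
    measure_sdiff (capCone_subset_ball _ _) (measurableSet_capCone _ _).nullMeasurableSet
      (lt_of_le_of_lt (measure_mono (μ := volume) (capCone_subset_ball (-a) s))
        measure_ball_lt_top).ne
  have hle := measure_mono (μ := volume) hUsub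
  rw [hUvol, hdiff, EuclideanSpace.volume_ball_fin_three] at hle
  rcases eq_or_lt_of_le hs0 with hszero | hspos
  · -- `s = 0`: then `t = 0` and `c = 1`, the claim is `|X| · 0 ≤ 1 + 0 + 0`
    have ht0 : t = 0 := by linarith
    have hsq : Real.sqrt (1 - c ^ 2) = 0 := by linarith
    have hc_one : c = 1 := by
      have h2 : 1 - c ^ 2 = 0 := by
        have := Real.sqrt_eq_zero'.1 hsq
        nlinarith
      nlinarith
    rw [hsq, ht0, hc_one]; simp
  rw [volume_capCone hna hspos hs1, ← ENNReal.ofReal_pow zero_le_one, one_pow,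
    ENNReal.ofReal_one, one_mul] at hle
  have hfin : ENNReal.ofReal (π * 4 / 3) - ENNReal.ofReal (2 * π / 3 * (1 - s)) ≠ ⊤ :=
    ENNReal.sub_ne_top ENNReal.ofReal_ne_top
  have hle' := ENNReal.toReal_mono hfin hle
  rw [ENNReal.toReal_mul, ENNReal.toReal_natCast, ENNReal.toReal_ofReal (by nlinarith [pi_pos]),
    ENNReal.toReal_sub_of_le (ENNReal.ofReal_le_ofReal (by nlinarith [pi_pos]))
      ENNReal.ofReal_ne_top,
    ENNReal.toReal_ofReal (by positivity), ENNReal.toReal_ofReal (by nlinarith [pi_pos])] at hle'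
  have hπ : 0 < 2 * π / 3 := by positivity
  nlinarith

/-- **Facets of twelve soft unit vectors have height `> 1/10`**: if `|X| = 12`, pairwise
`⟪·,·⟫ ≤ 0.502` (`= 1/2 + 2η` at `η = 10⁻³`), then `‖c‖⁻¹ > 1/10` for every facet normal `c`
(cone count with `c = 0.86661`, `t = 1/10`: `12 · 0.13339 = 1.60068 > 1.59899 > 1 + √(1 − c²) + 0.1`). -/
theorem facet_height_gt {X : Finset (EuclideanSpace ℝ (Fin 3))} (hX1 : ∀ x ∈ X, ‖x‖ = 1)
    (h12 : X.card = 12)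
    (hsep : ∀ x ∈ X, ∀ x' ∈ X, x ≠ x' → ⟪x, x'⟫ ≤ 502 / 1000)
    {c : EuclideanSpace ℝ (Fin 3)} (hc : c ∈ facetNormals X) : 1 / 10 < ‖c‖⁻¹ := by
  by_contra hle
  push Not at hle
  have hc0 := ne_zero_of_mem_facetNormals hX1 hc
  have hcpos : 0 < ‖c‖ := norm_pos_iff.2 hc0
  set a : EuclideanSpace ℝ (Fin 3) := -facetAxis c with ha
  have ha1 : ‖a‖ = 1 := by rw [ha, norm_neg]; exact norm_facetAxis hc0
  -- every point lies above the level `−1/10` of `a = −axis`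
  have habove : ∀ x ∈ X, -(1 / 10 : ℝ) ≤ ⟪a, x⟫ := by
    intro x hx
    have h1 : ⟪c, x⟫ ≤ 1 := (mem_facetNormals.1 hc).1 x hx
    have h2 : ⟪facetAxis c, x⟫ ≤ ‖c‖⁻¹ := by
      rw [facetAxis, real_inner_smul_left]
      calc ‖c‖⁻¹ * ⟪c, x⟫ ≤ ‖c‖⁻¹ * 1 := mul_le_mul_of_nonneg_left h1 (inv_nonneg.2 hcpos.le)
        _ = ‖c‖⁻¹ := mul_one _
    rw [ha, inner_neg_left]
    linarith
  have hsq : Real.sqrt (1 - (86661 / 100000 : ℝ) ^ 2) < 49899 / 100000 := by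
    rw [Real.sqrt_lt' (by norm_num)]; norm_num
  have hsq0 : 0 ≤ Real.sqrt (1 - (86661 / 100000 : ℝ) ^ 2) := Real.sqrt_nonneg _
  have h := card_mul_le_of_code_above hX1 (c := 86661 / 100000) (by norm_num) (by norm_num)
    (fun x hx x' hx' hne => by have := hsep x hx x' hx' hne; norm_num; linarith) ha1
    (t := 1 / 10) (by norm_num) (by linarith) habove
  rw [h12] at h
  have h' : (12 : ℝ) * (1 - 86661 / 100000) ≤
      1 + Real.sqrt (1 - (86661 / 100000 : ℝ) ^ 2) + 1 / 10 := by exact_mod_cast h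
  linarith

/-- **Two vertices of one facet have inner product `> −98/100`** (twelve unit vectors, pairwise
`⟪·,·⟫ ≤ 0.502`): both lie on the cap `⟪axis, ·⟫ = t` with `t > 1/10`, so
`⟪y, y'⟫ ≥ 2t² − 1 > −0.98`. -/
theorem inner_gt_of_common_facet {X : Finset (EuclideanSpace ℝ (Fin 3))} (hX1 : ∀ x ∈ X, ‖x‖ = 1)
    (h12 : X.card = 12)
    (hsep : ∀ x ∈ X, ∀ x' ∈ X, x ≠ x' → ⟪x, x'⟫ ≤ 502 / 1000)
    {c : EuclideanSpace ℝ (Fin 3)} (hc : c ∈ facetNormals X)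
    {y y' : EuclideanSpace ℝ (Fin 3)} (hy : y ∈ tightSet X c) (hy' : y' ∈ tightSet X c) :
    -(98 : ℝ) / 100 < ⟪y, y'⟫ := by
  set a := facetAxis c with ha
  set t := ‖c‖⁻¹ with ht
  have ha1 : ‖a‖ = 1 := norm_facetAxis (ne_zero_of_mem_facetNormals hX1 hc)
  have hya : ⟪a, y⟫ = t := inner_facetAxis_of_tight (mem_tightSet.1 hy).2
  have hy'a : ⟪a, y'⟫ = t := inner_facetAxis_of_tight (mem_tightSet.1 hy').2
  have htenth : 1 / 10 < t := facet_height_gt hX1 h12 hsep hc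
  have ht1 : t < 1 := hya ▸ inner_facetAxis_lt_one hX1 hc hy
  have hy1 := hX1 y (mem_tightSet.1 hy).1
  have hy'1 := hX1 y' (mem_tightSet.1 hy').1
  have h1 := (norm_sub_smul_sq_of_cap ha1 hy1 hya).1
  have h2 := (norm_sub_smul_sq_of_cap ha1 hy'1 hy'a).1
  have hcs := real_inner_mul_inner_self_le (y - t • a) (y' - t • a)
  rw [inner_sub_smul_of_cap ha1 hya hy'a, h1, h2] at hcs
  have hle1 : ⟪y, y'⟫ ≤ 1 := by
    have := real_inner_le_norm y y'; rw [hy1, hy'1, mul_one] at this; exact this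
  -- `(⟪y,y'⟫ − t²)² ≤ (1 − t²)²` with `0 < 1 − t²` gives `⟪y,y'⟫ ≥ 2t² − 1 > −0.98`
  nlinarith

end Summit.AtomisticToContinuum.Crystallization.Theorems

end
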